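import Mathlib
import HarnessLib
import Summits.HubbardSuperconductivity.HubbardSuperconductivity.Theorems.KLProgrammeKLRegimeEngineTwoLegSpLegGridDataFour
import Summits.HubbardSuperconductivity.HubbardSuperconductivity.Theorems.KLProgrammeKLRegimeEngineTwoLegCutLegGridData
import Summits.HubbardSuperconductivity.HubbardSuperconductivity.Theorems.KLProgrammeKLRegimeEngineTwoLegGridLegDoors
import Summits.HubbardSuperconductivity.HubbardSuperconductivity.Theorems.KLProgrammeKLRegimeEngineIsoTupleSmallness

/-!
# Route `KLProgramme` — ENGINE child gen 8 (stmt-HubbardSuperconductivity-20437 `KLRegimeEngineV17F2`), stub (e) `stub_twoLeg_step` under the v2 render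
# of record rev 4′-(C) («(Y′) keyed GRID», plan g19 (R59ac)/(R59ae)): THE (e) CLOSER MODULO THE VL ROWS — all package/threshold arithmetic discharged
# (cell gate-hubbard-kl, seat hubbard-kl-r2d-p1 g8)

rev 4′-(C) (`engine-flow-v2x.dryrun-r4pC-Yprime.lean` 261edc715b59c3a5, confirmed KL STATUS 2026-08-27) gives stub (e), as its LAST binder, the GRID two-leg
atom at EVERY scale `n' ≤ n` and EVERY comparison volume under the comparison history:
`hGs : ∀ n' ≤ n, ∀ L₁ M₁, L ≤ L₁ → Q.M0 β L₁ ≤ M₁ → (∀ j < n', histV17F2 L₁ M₁ … j ∧ TwoLegSlopes …) → TwoLegGridMomentsAt L₁ M₁ (2^10·e¹⁸κ₀⁴·klE3Acum R)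
(2^11·…) β U μ (K_{n'}(L₁,M₁)) n'`.  This file composes, ONCE and raise-generically (any `Q` with `(klEngQ7 P R).IsRaiseOf Q`: `klEngQ8`, `klEngQ9`),
everything this lineage and k3c5-p2 landed for stub (e) into ONE theorem whose only hypotheses beyond the stub's own binders + `hGs` are the VL lanes'
per-scale (D) ROWS (the ε-weighted pinned dual row DEFECTS across two volumes at `±ω₀`, C2 through the centred lift + far fine rows, C1 on one torus) with
their allowances `Dd n' + Df n' ≤ d·4^{n'}/3`, `Dc n' ≤ d·4^{n'}/3` for some `0 ≤ d ≤ Q.CL β 0/4`: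

**`stub_twoLeg_step_of_gridBinder_dualRows_raise`** ⟹ `TwoLegStepV17F2 L M klEngGeo8 P Q R β U μ n`.  Discharged inside (so the v2-day closer is
`this … hGs hdualSp hdualCut`): B1′/B2′ at the base volume (`hGs n le_rfl L M`, slopes history from `HistP`); the allowance rows (`le_rfl` at the literals);
rows C1/C2 (`cutLeg_/spLeg_allScales_of_gridMoments_V17F2_geometric4` fed by ONE projection of `hGs`); their n-free smallness
(`twoLeg_gridLegSmallness_of_doors`, inside `klEngU₀10 ≤ klE3U₀all ∧ ≤ klCurveU0`); the geometric volume line `Q.CL β 0·4^{n'} = Q.CL β n'`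
(`IsRaiseOf.CL_eq`, `klEngQ7_CL_apply`); `Q.M0 = klEngM₃` (`IsRaiseOf.M0_eq`, `rfl`); the regime conversions (`klEngC₃6 ≤ klCurveC3`,
`klEngU₀10 ≤ klEngU₀9 ≤ klEngU₀3 ≤ klCurveU0`, `klEngL₄ ⇒ klEngL₃`); the bare frame `klFrameOK_zeroC`.

Proofs only; no definitions; nothing about the model is asserted (the theorem is an implication from the stub's binders and the named rows);
nothing asserts superconductivity.  References: BGM 2006 §2.4 (2.23), (2.36), §3 [cite: BenfattoGiulianiMastropietro2006].
-/

noncomputable section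

namespace Summit.HubbardSuperconductivity.HubbardSuperconductivity.Theorems.EngineV8

set_option linter.dupNamespace false -- summit = problem name (single-conjunct summit), D-0017

open Real Finset Complex Literature.MathematicalPhysics.QuantumLattice Literature.Probability.LatticeModels GrassmannAlgebra
open Literature.MathematicalPhysics.QuantumLattice.FermiRG Literature.MathematicalPhysics.QuantumLattice.BandSectorCounting
open Summit.HubbardSuperconductivity.HubbardSuperconductivity.Theorems.KLProgrammeLegKernels
open Summit.HubbardSuperconductivity.HubbardSuperconductivity.Theorems.DispersionFlow
open Summit.HubbardSuperconductivity.HubbardSuperconductivity.Theorems.PerturbedFermiCurve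
open Summit.HubbardSuperconductivity.HubbardSuperconductivity.Theorems.KLRegimeSplit
open Summit.HubbardSuperconductivity.HubbardSuperconductivity.Theorems.TwoPointAssembly
open Summit.HubbardSuperconductivity.HubbardSuperconductivity.Theorems.TwoVolumeDefect
open Summit.HubbardSuperconductivity.HubbardSuperconductivity.Theorems.TwoLegFourier

/-- **STUB (e) UNDER rev 4′-(C), MODULO THE VL ROWS, RAISE-GENERIC.**  Package: any raise `Q` of `klEngQ7 P R`, geometry `klEngGeo8`, reading-jet table
`cJ ≤ klEngGeo7.S`.  Binders: stub (e)'s v2 list (doors `klEngC₃6`, `klEngU₀10`, `klEngL₄`, `klEngM₃`; history, frame, engine bounds, `hJ`) + the grid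
binder `hGs` of rev 4′-(C) + the VL (D) rows of rows C2 (`hdualSp`) and C1 (`hdualCut`) at every scale `n' ≤ n` with allowances `hDsum`, `hDc` for a rate
seed `0 ≤ d ≤ Q.CL β 0/4` ⟹ `TwoLegStepV17F2 L M klEngGeo8 P Q R β U μ n`. -/
theorem stub_twoLeg_step_of_gridBinder_dualRows_raise (P : SplitConsts) (R : RenConsts) (c : ℝ) (Q : EngConsts)
    (hQ : (klEngQ7 P R).IsRaiseOf Q) (cJ : ℕ → ℝ) (hC : ∀ k, cJ k ≤ klEngGeo7.S k) (hP : P.WF) (hR : R.WF2) (hc : 0 < c)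
    (hc3 : c ≤ klEngC₃6 P R) (μ : ℝ) (hμ : μ ∈ klWindowC) (U : ℝ) (hU : 0 < U) (hUle : U ≤ klEngU₀10 P R c) (β : ℝ) (hβ : klBetaMin ≤ β)
    (hβc : β ≤ Real.exp (c / U ^ 2)) (L M : ℕ) [NeZero L] [NeZero M] (hL : klEngL₄ P R β U ≤ L) (hM : klEngM₃ β U L ≤ M)
    (n : ℕ) (hn1 : 1 ≤ n) (hn : n ≤ nScales β + 1) (hreg : IsKLRegime U c (-(n : ℤ)))
    (hhist : HistP klPredsV17F2 L M klEngGeo8 P Q R β U μ 0 n)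
    (hfr : FrameOK R U (nScales β) μ (klFlowFrameU L M β U μ n))
    (hE : EngineBoundsAtV17F2 L M klEngGeo8 P Q β U μ n)
    (hJ : TwoLegReadJetBound L M cJ (klC4aJetC' P R) β U μ (klFlowFrameU L M β U μ n) n)
    (hGs : ∀ n' ≤ n, ∀ (L₁ M₁ : ℕ) [NeZero L₁] [NeZero M₁], L ≤ L₁ → Q.M0 β L₁ ≤ M₁ →
      (∀ j < n', histV17F2 L₁ M₁ klEngGeo8 P Q R β U μ j ∧ TwoLegSlopes L₁ M₁ R β U μ (klFlowFrameU L₁ M₁ β U μ j) j) →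
        TwoLegGridMomentsAt L₁ M₁ ((2 : ℝ) ^ 10 * Real.exp 1 ^ 18 * Real.sqrt (2 * (7 + 1606732)) ^ 4 * klE3Acum R)
          ((2 : ℝ) ^ 11 * Real.exp 1 ^ 18 * Real.sqrt (2 * (7 + 1606732)) ^ 4 * klE3Acum R) β U μ (klFlowFrameU L₁ M₁ β U μ n') n')
    {d : ℝ} (hd : 0 ≤ d) (hdCL : d ≤ Q.CL β 0 / 4) {Dd Df Dc : ℕ → ℝ}
    (hDsum : ∀ n' ≤ n, Dd n' + Df n' ≤ d * (4 : ℝ) ^ n' / 3) (hDc : ∀ n' ≤ n, Dc n' ≤ d * (4 : ℝ) ^ n' / 3)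
    (hdualSp : ∀ n' ≤ n, ∀ (Mq : ℕ → ℕ) (L₁ L₂ M₂ : ℕ) [NeZero L₁] [NeZero L₂] [NeZero M₂], L ≤ L₁ → L₁ ∣ L₂ → Q.M0 β L₁ ≤ M₂ →
      Mq L₁ ≤ M₂ → Q.M0 β L₂ ≤ M₂ → Mq L₂ ≤ M₂ →
      (∀ j < n', histV17F2 L₁ M₂ klEngGeo8 P Q R β U μ j ∧ TwoLegSlopes L₁ M₂ R β U μ (klFlowFrameU L₁ M₂ β U μ j) j) →
      (∀ j < n', histV17F2 L₂ M₂ klEngGeo8 P Q R β U μ j ∧ TwoLegSlopes L₂ M₂ R β U μ (klFlowFrameU L₂ M₂ β U μ j) j) →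
      (∀ m < n', ∀ θ : ℝ, |klLocalPart L₁ M₂ β U μ (klFlowFrameU L₁ M₂ β U μ m) m θ -
        klLocalPart L₂ M₂ β U μ (klFlowFrameU L₂ M₂ β U μ m) m θ| ≤ d * (4 : ℝ) ^ m / L₁) →
      (∀ q : Fin 2 → ℝ, |(klFlowFrameU L₁ M₂ β U μ n').eval q - (klFlowFrameU L₂ M₂ β U μ n').eval q| ≤
        (∑ m ∈ range n', d * (4 : ℝ) ^ m) / L₁) →
      ∃ (oc : SpaceTimeIdx L₁ M₂) (of : SpaceTimeIdx L₂ M₂),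
        (∀ m ∈ ({omega0 M₂, (omega0 M₂).rev} : Finset (MatsubaraIdx M₂)), ∀ σ : Fin 2, imagTimeWeight β M₂ * ∑ ybar : TorusSite 2 L₁,
          (‖(∑ t₁ : ImagTimeIdx M₂,
              sectorisedKernel L₁ M₂ β (trivialMultiplier L₁ M₂)
                  (klEffectiveAction L₁ M₂ β U μ (klFlowFrameU L₁ M₂ β U μ n') klE0 n' - counterQuadratic L₁ M₂ β (klFlowFrameU L₁ M₂ β U μ n')) 2
                  (![((0, σ), 0), ((0, σ), 1)] : Fin 2 → SectorLeg 1) ![oc, (t₁, oc.2 + ybar)] *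
                Complex.exp (((matsubaraFreq β M₂ m * (imagTime β M₂ oc.1 - imagTime β M₂ t₁) : ℝ) : ℂ) * I)) -
            (∑ t₁ : ImagTimeIdx M₂,
              sectorisedKernel L₂ M₂ β (trivialMultiplier L₂ M₂)
                  (klEffectiveAction L₂ M₂ β U μ (klFlowFrameU L₂ M₂ β U μ n') klE0 n' - counterQuadratic L₂ M₂ β (klFlowFrameU L₂ M₂ β U μ n')) 2
                  (![((0, σ), 0), ((0, σ), 1)] : Fin 2 → SectorLeg 1) ![of, (t₁, of.2 + Torus.proj L₂ (Torus.cRep ybar))] *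
                Complex.exp (((matsubaraFreq β M₂ m * (imagTime β M₂ of.1 - imagTime β M₂ t₁) : ℝ) : ℂ) * I))‖ +
          ‖(∑ t₁ : ImagTimeIdx M₂,
              sectorisedKernel L₁ M₂ β (trivialMultiplier L₁ M₂)
                  (klEffectiveAction L₁ M₂ β U μ (klFlowFrameU L₁ M₂ β U μ n') klE0 n' - counterQuadratic L₁ M₂ β (klFlowFrameU L₁ M₂ β U μ n')) 2
                  (![((0, σ), 0), ((0, σ), 1)] : Fin 2 → SectorLeg 1) ![oc, (t₁, oc.2 + -ybar)] *
                Complex.exp (((matsubaraFreq β M₂ m * (imagTime β M₂ oc.1 - imagTime β M₂ t₁) : ℝ) : ℂ) * I)) -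
            (∑ t₁ : ImagTimeIdx M₂,
              sectorisedKernel L₂ M₂ β (trivialMultiplier L₂ M₂)
                  (klEffectiveAction L₂ M₂ β U μ (klFlowFrameU L₂ M₂ β U μ n') klE0 n' - counterQuadratic L₂ M₂ β (klFlowFrameU L₂ M₂ β U μ n')) 2
                  (![((0, σ), 0), ((0, σ), 1)] : Fin 2 → SectorLeg 1) ![of, (t₁, of.2 + -Torus.proj L₂ (Torus.cRep ybar))] *
                Complex.exp (((matsubaraFreq β M₂ m * (imagTime β M₂ of.1 - imagTime β M₂ t₁) : ℝ) : ℂ) * I))‖) ≤ Dd n' / L₁) ∧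
        (∀ m ∈ ({omega0 M₂, (omega0 M₂).rev} : Finset (MatsubaraIdx M₂)), ∀ σ : Fin 2, imagTimeWeight β M₂ *
          ∑ y ∈ univ.filter (fun y : TorusSite 2 L₂ => Torus.proj L₂ (Torus.cRep (fun i => (((y i).val : ℕ) : ZMod L₁))) ≠ y),
          (‖(∑ t₁ : ImagTimeIdx M₂,
              sectorisedKernel L₂ M₂ β (trivialMultiplier L₂ M₂)
                  (klEffectiveAction L₂ M₂ β U μ (klFlowFrameU L₂ M₂ β U μ n') klE0 n' - counterQuadratic L₂ M₂ β (klFlowFrameU L₂ M₂ β U μ n')) 2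
                  (![((0, σ), 0), ((0, σ), 1)] : Fin 2 → SectorLeg 1) ![of, (t₁, of.2 + y)] *
                Complex.exp (((matsubaraFreq β M₂ m * (imagTime β M₂ of.1 - imagTime β M₂ t₁) : ℝ) : ℂ) * I))‖ +
          ‖(∑ t₁ : ImagTimeIdx M₂,
              sectorisedKernel L₂ M₂ β (trivialMultiplier L₂ M₂)
                  (klEffectiveAction L₂ M₂ β U μ (klFlowFrameU L₂ M₂ β U μ n') klE0 n' - counterQuadratic L₂ M₂ β (klFlowFrameU L₂ M₂ β U μ n')) 2
                  (![((0, σ), 0), ((0, σ), 1)] : Fin 2 → SectorLeg 1) ![of, (t₁, of.2 + -y)] *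
                Complex.exp (((matsubaraFreq β M₂ m * (imagTime β M₂ of.1 - imagTime β M₂ t₁) : ℝ) : ℂ) * I))‖) ≤ Df n' / L₁))
    (hdualCut : ∀ n' ≤ n, ∀ (Mq : ℕ → ℕ) (L₁ M₁ M₂ : ℕ) [NeZero L₁] [NeZero M₁] [NeZero M₂], L ≤ L₁ → Q.M0 β L₁ ≤ M₁ → Mq L₁ ≤ M₁ →
      M₁ ≤ M₂ →
      (∀ j < n', histV17F2 L₁ M₁ klEngGeo8 P Q R β U μ j ∧ TwoLegSlopes L₁ M₁ R β U μ (klFlowFrameU L₁ M₁ β U μ j) j) →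
      (∀ j < n', histV17F2 L₁ M₂ klEngGeo8 P Q R β U μ j ∧ TwoLegSlopes L₁ M₂ R β U μ (klFlowFrameU L₁ M₂ β U μ j) j) →
      (∀ m < n', ∀ θ : ℝ, |klLocalPart L₁ M₁ β U μ (klFlowFrameU L₁ M₁ β U μ m) m θ -
        klLocalPart L₁ M₂ β U μ (klFlowFrameU L₁ M₂ β U μ m) m θ| ≤ d * (4 : ℝ) ^ m / L₁) →
      (∀ q : Fin 2 → ℝ, |(klFlowFrameU L₁ M₁ β U μ n').eval q - (klFlowFrameU L₁ M₂ β U μ n').eval q| ≤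
        (∑ m ∈ range n', d * (4 : ℝ) ^ m) / L₁) →
      ∃ (o₁ : SpaceTimeIdx L₁ M₁) (o₂ : SpaceTimeIdx L₁ M₂),
        (∀ σ : Fin 2, ∑ y : TorusSite 2 L₁,
          (‖(imagTimeWeight β M₁ : ℂ) * (∑ t₁ : ImagTimeIdx M₁,
              sectorisedKernel L₁ M₁ β (trivialMultiplier L₁ M₁)
                  (klEffectiveAction L₁ M₁ β U μ (klFlowFrameU L₁ M₁ β U μ n') klE0 n' - counterQuadratic L₁ M₁ β (klFlowFrameU L₁ M₁ β U μ n')) 2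
                  (![((0, σ), 0), ((0, σ), 1)] : Fin 2 → SectorLeg 1) ![o₁, (t₁, o₁.2 + y)] *
                Complex.exp (((matsubaraFreq β M₁ (omega0 M₁) * (imagTime β M₁ o₁.1 - imagTime β M₁ t₁) : ℝ) : ℂ) * I)) -
            (imagTimeWeight β M₂ : ℂ) * (∑ t₁ : ImagTimeIdx M₂,
              sectorisedKernel L₁ M₂ β (trivialMultiplier L₁ M₂)
                  (klEffectiveAction L₁ M₂ β U μ (klFlowFrameU L₁ M₂ β U μ n') klE0 n' - counterQuadratic L₁ M₂ β (klFlowFrameU L₁ M₂ β U μ n')) 2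
                  (![((0, σ), 0), ((0, σ), 1)] : Fin 2 → SectorLeg 1) ![o₂, (t₁, o₂.2 + y)] *
                Complex.exp (((matsubaraFreq β M₂ (omega0 M₂) * (imagTime β M₂ o₂.1 - imagTime β M₂ t₁) : ℝ) : ℂ) * I))‖ +
          ‖(imagTimeWeight β M₁ : ℂ) * (∑ t₁ : ImagTimeIdx M₁,
              sectorisedKernel L₁ M₁ β (trivialMultiplier L₁ M₁)
                  (klEffectiveAction L₁ M₁ β U μ (klFlowFrameU L₁ M₁ β U μ n') klE0 n' - counterQuadratic L₁ M₁ β (klFlowFrameU L₁ M₁ β U μ n')) 2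
                  (![((0, σ), 0), ((0, σ), 1)] : Fin 2 → SectorLeg 1) ![o₁, (t₁, o₁.2 + -y)] *
                Complex.exp (((matsubaraFreq β M₁ (omega0 M₁) * (imagTime β M₁ o₁.1 - imagTime β M₁ t₁) : ℝ) : ℂ) * I)) -
            (imagTimeWeight β M₂ : ℂ) * (∑ t₁ : ImagTimeIdx M₂,
              sectorisedKernel L₁ M₂ β (trivialMultiplier L₁ M₂)
                  (klEffectiveAction L₁ M₂ β U μ (klFlowFrameU L₁ M₂ β U μ n') klE0 n' - counterQuadratic L₁ M₂ β (klFlowFrameU L₁ M₂ β U μ n')) 2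
                  (![((0, σ), 0), ((0, σ), 1)] : Fin 2 → SectorLeg 1) ![o₂, (t₁, o₂.2 + -y)] *
                Complex.exp (((matsubaraFreq β M₂ (omega0 M₂) * (imagTime β M₂ o₂.1 - imagTime β M₂ t₁) : ℝ) : ℂ) * I))‖) ≤ Dc n' / L₁) ∧
        (∀ σ : Fin 2, ∑ y : TorusSite 2 L₁,
          (‖(imagTimeWeight β M₁ : ℂ) * (∑ t₁ : ImagTimeIdx M₁,
              sectorisedKernel L₁ M₁ β (trivialMultiplier L₁ M₁)
                  (klEffectiveAction L₁ M₁ β U μ (klFlowFrameU L₁ M₁ β U μ n') klE0 n' - counterQuadratic L₁ M₁ β (klFlowFrameU L₁ M₁ β U μ n')) 2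
                  (![((0, σ), 0), ((0, σ), 1)] : Fin 2 → SectorLeg 1) ![o₁, (t₁, o₁.2 + y)] *
                Complex.exp (((matsubaraFreq β M₁ (omega0 M₁).rev * (imagTime β M₁ o₁.1 - imagTime β M₁ t₁) : ℝ) : ℂ) * I)) -
            (imagTimeWeight β M₂ : ℂ) * (∑ t₁ : ImagTimeIdx M₂,
              sectorisedKernel L₁ M₂ β (trivialMultiplier L₁ M₂)
                  (klEffectiveAction L₁ M₂ β U μ (klFlowFrameU L₁ M₂ β U μ n') klE0 n' - counterQuadratic L₁ M₂ β (klFlowFrameU L₁ M₂ β U μ n')) 2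
                  (![((0, σ), 0), ((0, σ), 1)] : Fin 2 → SectorLeg 1) ![o₂, (t₁, o₂.2 + y)] *
                Complex.exp (((matsubaraFreq β M₂ (omega0 M₂).rev * (imagTime β M₂ o₂.1 - imagTime β M₂ t₁) : ℝ) : ℂ) * I))‖ +
          ‖(imagTimeWeight β M₁ : ℂ) * (∑ t₁ : ImagTimeIdx M₁,
              sectorisedKernel L₁ M₁ β (trivialMultiplier L₁ M₁)
                  (klEffectiveAction L₁ M₁ β U μ (klFlowFrameU L₁ M₁ β U μ n') klE0 n' - counterQuadratic L₁ M₁ β (klFlowFrameU L₁ M₁ β U μ n')) 2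
                  (![((0, σ), 0), ((0, σ), 1)] : Fin 2 → SectorLeg 1) ![o₁, (t₁, o₁.2 + -y)] *
                Complex.exp (((matsubaraFreq β M₁ (omega0 M₁).rev * (imagTime β M₁ o₁.1 - imagTime β M₁ t₁) : ℝ) : ℂ) * I)) -
            (imagTimeWeight β M₂ : ℂ) * (∑ t₁ : ImagTimeIdx M₂,
              sectorisedKernel L₁ M₂ β (trivialMultiplier L₁ M₂)
                  (klEffectiveAction L₁ M₂ β U μ (klFlowFrameU L₁ M₂ β U μ n') klE0 n' - counterQuadratic L₁ M₂ β (klFlowFrameU L₁ M₂ β U μ n')) 2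
                  (![((0, σ), 0), ((0, σ), 1)] : Fin 2 → SectorLeg 1) ![o₂, (t₁, o₂.2 + -y)] *
                Complex.exp (((matsubaraFreq β M₂ (omega0 M₂).rev * (imagTime β M₂ o₂.1 - imagTime β M₂ t₁) : ℝ) : ℂ) * I))‖) ≤ Dc n' / L₁)) :
    TwoLegStepV17F2 L M klEngGeo8 P Q R β U μ n := by
  have _ := hP
  -- regime conversions from the registered thresholds
  have hRge : ∀ j, 0 ≤ R.Gfr j := hR.1.2.2
  have hcle : c ≤ klCurveC3 R := hc3.trans ((klEngC₃6_le_klEngC₃3 P R).trans (klEngC₃3_le_klCurveC3 P hRge))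
  have hU9 : U ≤ klEngU₀9 P R c := hUle.trans (klEngU₀10_le_klEngU₀9 P R c)
  have hU3 : U ≤ klEngU₀3 P R c := hU9.trans (klEngU₀9_le_klEngU₀3 P R c)
  have hUc : U ≤ klCurveU0 R := hU3.trans (klEngU₀3_le_klCurveU0 P hRge c)
  have hUall : U ≤ klE3U₀all R := hUle.trans (klEngU₀10_le_klE3U₀all P R c)
  have hL3 : klEngL₃ β U ≤ L := klEngL₃_le_of_klEngL₄_le hL
  have h0 : FrameOK R U (nScales β) μ 0 := klFrameOK_zeroC hR.1 U (nScales β) hμ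
  have hβ0 : 0 < β := lt_of_lt_of_le (by norm_num [klBetaMin]) hβ
  -- package rows along the raise
  have hCL : ∀ n' ≤ n, Q.CL β 0 * (4 : ℝ) ^ n' ≤ Q.CL β n' := fun n' _ => le_of_eq (by
    rw [hQ.CL_eq, klEngQ7_CL_apply, klEngQ7_CL_apply]; ring)
  have hM0 : Q.M0 β L ≤ M := by rw [hQ.M0_eq]; exact hM
  -- the n-free smallness of the nested legs is inside the doors
  have hZs0 : (0 : ℝ) ≤ (2 : ℝ) ^ 11 * Real.exp 1 ^ 18 * Real.sqrt (2 * (7 + 1606732)) ^ 4 * klE3Acum R := by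
    have := klE3Acum_pos R; positivity
  have hsmall := twoLeg_gridLegSmallness_of_doors (hRge 0) (hRge 1) hU hUall hUc
  -- row C2 and row C1 from the grid binder and the VL rows
  have hsp := spLeg_allScales_of_gridMoments_V17F2_geometric4 (G := klEngGeo8) (P := P) hRge hc hcle hU hUc hβ hβc hμ hL3 h0 hn hd hdCL hCL
    hZs0 hsmall hDsum (fun n'' hn'' Mq L₁ L₂ M₂ _ _ _ hLL₁ _ hM₁ _ _ _ hh₁ _ _ _ => hGs n'' hn'' L₁ M₂ hLL₁ hM₁ hh₁) hdualSp n le_rfl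
  have hcut := cutLeg_allScales_of_gridMoments_V17F2_geometric4 (G := klEngGeo8) (P := P) hRge hc hcle hU hUc hβ hβc hμ hL3 h0 hn hd hdCL hCL
    hZs0 hsmall hDc (fun n'' hn'' Mq L₁ M₁ M₂ _ _ _ hLL₁ hM₁ _ _ hh₁ _ _ _ => hGs n'' hn'' L₁ M₁ hLL₁ hM₁ hh₁) hdualCut n le_rfl
  -- rows B1′/B2′ at the base volume: the grid binder at (L, M, n) with the slopes history from `HistP`
  have hgrid : TwoLegGridFlowMomentsAt L M ((2 : ℝ) ^ 10 * Real.exp 1 ^ 18 * Real.sqrt (2 * (7 + 1606732)) ^ 4 * klE3Acum R)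
      ((2 : ℝ) ^ 11 * Real.exp 1 ^ 18 * Real.sqrt (2 * (7 + 1606732)) ^ 4 * klE3Acum R) β U μ n :=
    hGs n le_rfl L M le_rfl hM0 (fun j hj => ⟨histV17F2_of_histP hhist j hj, ((histP_klPredsV17F2_iff L M klEngGeo8 P Q R β U μ 0 n).1 hhist j hj).2.2.2.2.1⟩)
  exact stub_twoLeg_step_of_twoLegGridMomentsAt_raise P R c Q hQ cJ hC hP hR hc hc3 μ hμ U hU hUle β hβ hβc L M hL hM n hn1 hn hreg hhist hfr hE hJ
    hgrid le_rfl le_rfl hcut hsp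

end Summit.HubbardSuperconductivity.HubbardSuperconductivity.Theorems.EngineV8

end
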